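import Mathlib
import Literature.NumberTheory.Irrationality.BrownZudilin2022.WellPoisedDual
import HarnessLib

/-!
# Zudilin 2004, §4: the Rhin–Viola group structure for `ζ(3)` = Bailey's `₇F₆` transformation in integer clothing

Topic `Literature/NumberTheory/Irrationality/Zudilin2004`. Typed, cited statement (ONE named fact, no proof) with
PROVED companions, read on the page from W. Zudilin, *Arithmetic of linear forms involving odd zeta values*,
J. Théor. Nombres Bordeaux **16** (2004) 251–291 = arXiv:math/0206176 [Zudilin2004], Sect. 3–4 (arXiv text
pp. 7–11: (3.1)–(3.2), (3.9), Prop. 2, Lemma 7 with (4.4)–(4.6), Lemma 8 with (4.7), and the sentence "Since the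
group `𝔊` does not change (4.4), we arrive at … Lemma 9 (cf. [RV3], Section 4)"). Companion reading:
F. Brown, W. Zudilin, arXiv:2210.03391 [BrownZudilin2022], Sect. 7, who use the same transformation of Bailey
([Bailey 1935, §6.3 (2)], [Slater 1966, (4.7.1.3)]) for their Barnes integrals. HONEST FRAMING (cell pub-zeta5):
systematic search; no irrationality claim unless certified — an identity of special functions, no arithmetic
claim about `ζ(3)` or `ζ(5)`.

## What is printed
Zudilin's normalised very-well-poised series (4.2),
`F̃(h) = F̃(h₀;h₁,…,h₅) = Γ(1+h₀)∏_{j=1}^{5}Γ(h_j)/∏_{j=1}^{5}Γ(1+h₀−h_j) · ₇F₆(h₀, 1+h₀/2, h₁,…,h₅; h₀/2, 1+h₀−h₁,…; 1)`,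
is TERMWISE the tree's `Zudilin2002.vwpSeries 5 h = Σ_μ (h₀+2μ) ∏_{j=0}^{5} Γ(h_j+μ)/Γ(1+h₀−h_j+μ)`, hence
Brown–Zudilin's `F̃₅(B) = vwpDual 5 B` at `h₀ = B₀+2`, `h_j = B_j+1` (`BrownZudilin2022.hOfB`). Lemma 7 (from
Bailey's identity, Prop. 2): under (3.9),
`G̃(a,b)/(∏_j(a_j−b₁)!·∏_j(a_j−b₂)!) = F̃(h)/(∏_{j=1}^{5}(h_j−1)!·(1+2h₀−h₁−h₂−h₃−h₄−h₅)!)`            (4.4)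
with (4.5)–(4.6) relating `(a;b)` (normalised by `b₁ = 1`) and `h`: `a₁ = 1+h₀−h₄−h₅, a₂ = h₁, a₃ = h₂, a₄ = h₃,
b₂ = h₁+h₂+h₃−h₀, b₃ = 1+h₀−h₄, b₄ = 1+h₀−h₅`; here `G̃(a,b) = −(−1)^{b₁+b₂}Σ_t R̃′(t)`,
`R̃(t) = ∏_{j=1}^{4}Γ(t+a_j)/∏_{k=1}^{4}Γ(t+b_k)` ((3.1)–(3.2)), which "do not depend on the order of numbers in the
sets `{a₁,a₂,a₃,a₄}`, `{b₁,b₂}`, and `{b₃,b₄}`". Hence (p. 9) "the permutations `𝔞_jk` … do not change the quantity on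
the left-hand side of (4.4) … the permutations `𝔞_1k`, `k = 2,3,4`, affect nontrivial transformations of the
parameters `h`", and (p. 10) "the group `𝔊` [of order 1920, Lemma 8, acting by permutations of the sixteen parameters
`c_jk` of (4.7)] does not change (4.4)". Admissible parameters ((4.12)): all sixteen `c_jk > 0`.

## The dictionary typed here (each line a two-line computation from (4.5)–(4.7); LITERATURE.md §I.39 of the cell)
With `B₀ = h₀ − 2`, `B_j = h_j − 1`: the sixteen `c_jk` are `B₁,…,B₅`, `2B₀ − Σ_jB_j` and the ten `B₀ − B_j − B_k`
(`cParams`); the right-hand side of (4.4) is `F̃₅(B)/Π(B)` with `Π(B) = ∏_{j=1}^{5}B_j! · (2B₀−Σ_jB_j)!` (`piNorm`);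
the generator `𝔞₁₂` (swap `a₁ ↔ a₂`) acts on `h` by
`(h₀;h₁,…,h₅) ↦ (1+2h₀−h₁−h₄−h₅; 1+h₀−h₄−h₅, h₂, h₃, 1+h₀−h₁−h₅, 1+h₀−h₁−h₄)`, i.e. on `B` by the involution
`𝔱 : (B₀;B₁,…,B₅) ↦ (B₀+δ; B₁+δ, B₂, B₃, B₄+δ, B₅+δ)`, `δ = B₀−B₁−B₄−B₅` (`tau`), which PERMUTES the sixteen
parameters (`admissible_tau`). The series converges iff `2+2h₀ > Σh_j` iff `2B₀ − Σ_jB_j ≥ 0`.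

## Contents
* PROVED: `vwpSeries_comp_swap`, `vwpDual_comp_swap` (the very-well-poised series is symmetric in its lower
  parameters — the `𝔥_jk` of the source), `tau_tau` (`𝔱` is an involution), `admissible_tau` (`𝔱` preserves
  admissibility: it permutes the `c_jk`), `piNorm_comp_swap`, `admissible_comp_swap35`, `tau134_eq`;
* NAMED FACT `baileyTransform` (PROVED tree-side: `Summits/KontsevichZagierPeriods/Zeta5Search/VWPOfPosConsequences.lean`
  `baileyTransform_holds` (p538491) — not restated here because Literature cannot import Summits): for admissible `B`,
  `F̃₅(B)/Π(B) = F̃₅(𝔱B)/Π(𝔱B)`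
  [Zudilin2004, §4: Lemma 7 (4.4)–(4.6) with the `𝔞₁₂`-symmetry of (3.2); "the group `𝔊` does not change (4.4)"
  before Lemma 9];
* PROVED corollary `baileyTransform.slots134`: the same for the conjugate involution on the slots `{1,3,4}`
  (`tau134`, the form used by the cell's gen-1 transport step), from the fact and the `S₅`-symmetry.
Not typed here: Lemma 9 itself (`H(c)/Π(c)` with `H(c) = G(a,b)` the Rhin–Viola integral / Meijer `G^{2,4}_{4,4}`),
the enumeration `|𝔊| = 1920`, and the arithmetic of Sect. 5 (`Φ`-factors, Rhin–Viola's measure).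
TODO(general form): the source's group acts on all of `(a;b)`; only the generator `𝔞₁₂` (with the `S₅`-symmetry,
which generates the `h`-side action) is typed.
-/

noncomputable section

open Finset

namespace Literature.NumberTheory.Irrationality.Zudilin2004

open BrownZudilin2022 (vwpDual hOfB)
open Zudilin2002 (vwpSeries)

/-! ### The very-well-poised series is symmetric in its lower parameters (PROVED) -/

/-- Swapping two of the lower parameters `h_i, h_j` (`1 ≤ i, j ≤ m`) leaves `F_m(h₀;h₁,…,h_m)` unchanged (the
permutations `𝔥_jk` "do not change the quantity on the right-hand side of (4.4)").
[cite: Zudilin2004, Sect. 4, paragraph after (4.6)] -/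
theorem vwpSeries_comp_swap (m : ℕ) (h : ℕ → ℝ) {i j : ℕ} (hi : i ∈ Icc 1 m) (hj : j ∈ Icc 1 m) :
    vwpSeries m (h ∘ Equiv.swap i j) = vwpSeries m h := by
  rw [mem_Icc] at hi hj
  have e0 : Equiv.swap i j 0 = 0 := Equiv.swap_apply_of_ne_of_ne (by omega) (by omega)
  have hs : {a | Equiv.swap i j a ≠ a} ⊆ ((range (m + 1) : Finset ℕ) : Set ℕ) := by
    intro a ha
    simp only [Set.mem_setOf_eq] at ha
    rw [Finset.mem_coe, mem_range]
    by_contra hlt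
    exact ha (Equiv.swap_apply_of_ne_of_ne (by omega) (by omega))
  unfold vwpSeries
  refine tsum_congr fun μ => ?_
  simp only [Function.comp, e0]
  congr 2
  exact Equiv.Perm.prod_comp (Equiv.swap i j) (range (m + 1))
    (fun k => Real.Gamma (h k + μ) / Real.Gamma (1 + h 0 - h k + μ)) hs

/-- `hOfB` commutes with swaps of two positive indices (bookkeeping for the `𝔥_jk`-symmetry).
[cite: Zudilin2004, Sect. 4, paragraph after (4.6)] -/
theorem hOfB_comp_swap (B : ℕ → ℤ) {i j : ℕ} (hi : 1 ≤ i) (hj : 1 ≤ j) :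
    hOfB (B ∘ Equiv.swap i j) = hOfB B ∘ Equiv.swap i j := by
  funext k
  have e0 : Equiv.swap i j 0 = 0 := Equiv.swap_apply_of_ne_of_ne (by omega) (by omega)
  by_cases hk : k = 0
  · subst hk
    simp [hOfB, e0]
  · have hk' : Equiv.swap i j k ≠ 0 := by
      intro h'
      apply hk
      have := congrArg (Equiv.swap i j) h'
      rwa [Equiv.swap_apply_self, e0] at this
    simp [hOfB, hk, hk']

/-- Brown–Zudilin's `F̃_k(B)` is symmetric in `B₁,…,B_k`. [cite: Zudilin2004, Sect. 4, paragraph after (4.6)] -/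
theorem vwpDual_comp_swap (k : ℕ) (B : ℕ → ℤ) {i j : ℕ} (hi : i ∈ Icc 1 k) (hj : j ∈ Icc 1 k) :
    vwpDual k (B ∘ Equiv.swap i j) = vwpDual k B := by
  have hi' := (mem_Icc.mp hi).1
  have hj' := (mem_Icc.mp hj).1
  unfold vwpDual
  rw [hOfB_comp_swap B hi' hj']
  exact vwpSeries_comp_swap k (hOfB B) hi hj

/-! ### The sixteen parameters, admissibility, the normaliser `Π`, and the generator `𝔱` -/

/-- The sixteen Rhin–Viola–Zudilin parameters `c_jk` of (4.7) in Brown–Zudilin's coordinates `B`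
(`B₀ = h₀−2`, `B_j = h_j−1`, `(a;b)` from (4.6) with `b₁ = 1`): `B₁,…,B₅`, `2B₀−Σ_jB_j`, and `B₀−B_j−B_k`
(`1 ≤ j < k ≤ 5`). [cite: Zudilin2004, Sect. 4, (4.6)–(4.7)] -/
def cParams (B : ℕ → ℤ) : List ℤ :=
  [B 1, B 2, B 3, B 4, B 5, 2 * B 0 - (B 1 + B 2 + B 3 + B 4 + B 5),
    B 0 - B 1 - B 2, B 0 - B 1 - B 3, B 0 - B 1 - B 4, B 0 - B 1 - B 5, B 0 - B 2 - B 3,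
    B 0 - B 2 - B 4, B 0 - B 2 - B 5, B 0 - B 3 - B 4, B 0 - B 3 - B 5, B 0 - B 4 - B 5]

/-- ADMISSIBLE parameters ((4.12): `c_jk > 0` for all `j, k = 1,…,4`), in the coordinates `B`.
[cite: Zudilin2004, Sect. 4, (4.12)] -/
def Admissible (B : ℕ → ℤ) : Prop := ∀ c ∈ cParams B, 0 < c

/-- Admissibility of concrete parameters is decidable (sixteen integer sign conditions).
[cite: Zudilin2004, Sect. 4, (4.12)] -/
instance (B : ℕ → ℤ) : Decidable (Admissible B) := by
  unfold Admissible; infer_instance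

/-- The normaliser of the right-hand side of (4.4) in the coordinates `B`:
`Π(B) = ∏_{j=1}^{5} B_j! · (2B₀ − Σ_{j=1}^{5} B_j)!` (`= ∏(h_j−1)! · (1+2h₀−h₁−…−h₅)!`; integer arguments through
`Int.toNat`, all non-negative on the admissible cone). [cite: Zudilin2004, Sect. 4, (4.4)] -/
def piNorm (B : ℕ → ℤ) : ℕ :=
  (∏ j ∈ range 5, (B (j + 1)).toNat.factorial) * (2 * B 0 - ∑ j ∈ range 5, B (j + 1)).toNat.factorial

/-- The generator `𝔞₁₂` (swap of `a₁, a₂` in `G̃(a,b)`) read on the parameters `h` through (4.5)–(4.6), in the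
coordinates `B`: `𝔱(B) = (B₀+δ; B₁+δ, B₂, B₃, B₄+δ, B₅+δ)`, `δ = B₀−B₁−B₄−B₅` (indices `≥ 6` untouched).
[cite: Zudilin2004, Sect. 4, (4.5)–(4.6)] -/
def tau (B : ℕ → ℤ) : ℕ → ℤ := fun j =>
  if j = 0 ∨ j = 1 ∨ j = 4 ∨ j = 5 then B j + (B 0 - B 1 - B 4 - B 5) else B j

/-- `𝔱` is an involution ("All these generators have order 2"). [cite: Zudilin2004, Sect. 4, Lemma 8] -/
theorem tau_tau (B : ℕ → ℤ) : tau (tau B) = B := by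
  funext j
  by_cases h : j = 0 ∨ j = 1 ∨ j = 4 ∨ j = 5
  · simp only [tau, h, if_true]
    norm_num
    ring
  · simp only [tau, h, if_false]

/-- `𝔱` PERMUTES the sixteen parameters `c_jk`, hence preserves admissibility (it is the product of the four
transpositions `B₁ ↔ B₀−B₄−B₅`, `B₄ ↔ B₀−B₁−B₅`, `B₅ ↔ B₀−B₁−B₄`, `2B₀−ΣB ↔ B₀−B₂−B₃`).
[cite: Zudilin2004, Sect. 4, Lemma 8] -/
theorem admissible_tau {B : ℕ → ℤ} (hB : Admissible B) : Admissible (tau B) := by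
  unfold Admissible cParams at hB ⊢
  simp only [List.mem_cons, List.not_mem_nil, or_false, forall_eq_or_imp, forall_eq] at hB ⊢
  simp only [tau]
  norm_num
  omega

/-! ### The named fact: the group does not change (4.4) -/

/-- **Zudilin 2004, Sect. 4 — the Rhin–Viola group structure for `ζ(3)` via Bailey's transformation** (named
fact; PROVED tree-side: `Summits/KontsevichZagierPeriods/Zeta5Search/VWPOfPosConsequences.lean` `baileyTransform_holds`
(p538491) — not restated here because Literature cannot import Summits). For ADMISSIBLE integer parameters `B = (B₀;B₁,…,B₅)` (all sixteen `c_jk > 0`), the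
quantity (4.4), `F̃₅(B)/Π(B)` with `Π(B) = ∏_{j=1}^{5}B_j!·(2B₀−Σ_jB_j)!`, is unchanged by the generator `𝔞₁₂` of the
group `𝔊`, i.e. `F̃₅(B)/Π(B) = F̃₅(𝔱B)/Π(𝔱B)` for the involution `𝔱` of `tau`. In the source this is Lemma 7
(Bailey's identity (4.4) between `G̃(a,b)/(∏(a_j−b₁)!∏(a_j−b₂)!)` and `F̃(h)/(∏(h_j−1)!(1+2h₀−Σh_j)!)`) combined with
the invariance of `G̃(a,b)` under permutations of `a₁,…,a₄` (after (3.2)) — "Since the group `𝔊` does not change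
(4.4)" (before Lemma 9); together with the `S₅`-symmetry `vwpDual_comp_swap` it generates the whole action of `𝔊` on
`h`. Rhin–Viola [RV3, Sect. 4] obtain the same group from the birational automorphisms of their triple integral.
[cite: Zudilin2004, Sect. 4, Lemma 7 with (4.4)–(4.6) and the paragraph before Lemma 9; Prop. 2 (Bailey's identity)] -/
def baileyTransform : Prop :=
  ∀ B : ℕ → ℤ, Admissible B →
    vwpDual 5 B / (piNorm B : ℝ) = vwpDual 5 (tau B) / (piNorm (tau B) : ℝ)

/-! ### The conjugate generator on the slots `{1,3,4}` (PROVED from the fact and the `S₅`-symmetry) -/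

/-- The conjugate of `𝔱` by the transposition of the slots `3, 5`:
`𝔱₁₃₄(B) = (B₀+δ; B₁+δ, B₂, B₃+δ, B₄+δ, B₅)`, `δ = B₀−B₁−B₃−B₄`. [cite: Zudilin2004, Sect. 4, Lemma 8] -/
def tau134 (B : ℕ → ℤ) : ℕ → ℤ := fun j =>
  if j = 0 ∨ j = 1 ∨ j = 3 ∨ j = 4 then B j + (B 0 - B 1 - B 3 - B 4) else B j

/-- `𝔱₁₃₄ = s ∘ 𝔱 ∘ s` with `s` the transposition of the slots `3` and `5` (conjugation inside `𝔊`).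
[cite: Zudilin2004, Sect. 4, Lemma 8] -/
theorem tau134_eq (B : ℕ → ℤ) : tau134 B = tau (B ∘ Equiv.swap 3 5) ∘ Equiv.swap 3 5 := by
  funext j
  simp only [tau134, tau, Function.comp]
  have s0 : Equiv.swap (3 : ℕ) 5 0 = 0 := Equiv.swap_apply_of_ne_of_ne (by norm_num) (by norm_num)
  have s1 : Equiv.swap (3 : ℕ) 5 1 = 1 := Equiv.swap_apply_of_ne_of_ne (by norm_num) (by norm_num)
  have s4 : Equiv.swap (3 : ℕ) 5 4 = 4 := Equiv.swap_apply_of_ne_of_ne (by norm_num) (by norm_num)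
  have s3 : Equiv.swap (3 : ℕ) 5 3 = 5 := Equiv.swap_apply_left _ _
  have s5 : Equiv.swap (3 : ℕ) 5 5 = 3 := Equiv.swap_apply_right _ _
  rw [s0, s1, s4, s5]
  by_cases h0 : j = 0
  · subst h0; simp [s0]; omega
  by_cases h1 : j = 1
  · subst h1; simp [s1]; omega
  by_cases h3 : j = 3
  · subst h3; simp [s3]; omega
  by_cases h4 : j = 4
  · subst h4; simp [s4]; omega
  by_cases h5 : j = 5
  · subst h5; simp [s5]
  have hj : Equiv.swap (3 : ℕ) 5 j = j := Equiv.swap_apply_of_ne_of_ne h3 h5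
  simp [hj, h0, h1, h3, h4, h5]

/-- `Π(B) = ∏(h_j−1)!·(1+2h₀−Σh_j)!` is symmetric in `B₁,…,B₅` (the `𝔥_jk` fix the right-hand side of (4.4)).
[cite: Zudilin2004, Sect. 4, paragraph after (4.6)] -/
theorem piNorm_comp_swap (B : ℕ → ℤ) {i j : ℕ} (hi : i ∈ Icc 1 5) (hj : j ∈ Icc 1 5) :
    piNorm (B ∘ Equiv.swap i j) = piNorm B := by
  rw [mem_Icc] at hi hj
  have e0 : Equiv.swap i j 0 = 0 := Equiv.swap_apply_of_ne_of_ne (by omega) (by omega)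
  -- the permutation of `range 5` induced on the shifted index `s ↦ s+1`
  have hs : {a | (Equiv.swap (i - 1) (j - 1)) a ≠ a} ⊆ ((range 5 : Finset ℕ) : Set ℕ) := by
    intro a ha
    simp only [Set.mem_setOf_eq] at ha
    rw [Finset.mem_coe, mem_range]
    by_contra hlt
    exact ha (Equiv.swap_apply_of_ne_of_ne (by omega) (by omega))
  have key : ∀ s : ℕ, Equiv.swap i j (s + 1) = Equiv.swap (i - 1) (j - 1) s + 1 := by
    intro s
    rcases eq_or_ne s (i - 1) with h1 | h1
    · subst h1
      rw [show i - 1 + 1 = i by omega, Equiv.swap_apply_left, Equiv.swap_apply_left]; omega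
    rcases eq_or_ne s (j - 1) with h2 | h2
    · subst h2
      rw [show j - 1 + 1 = j by omega, Equiv.swap_apply_right, Equiv.swap_apply_right]; omega
    rw [Equiv.swap_apply_of_ne_of_ne h1 h2, Equiv.swap_apply_of_ne_of_ne (by omega) (by omega)]
  have hprod : ∏ s ∈ range 5, ((B ∘ Equiv.swap i j) (s + 1)).toNat.factorial =
      ∏ s ∈ range 5, (B (s + 1)).toNat.factorial := by
    simp only [Function.comp, key]
    exact Equiv.Perm.prod_comp (Equiv.swap (i - 1) (j - 1)) (range 5)
      (fun s => (B (s + 1)).toNat.factorial) hs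
  have hsum : ∑ s ∈ range 5, (B ∘ Equiv.swap i j) (s + 1) = ∑ s ∈ range 5, B (s + 1) := by
    simp only [Function.comp, key]
    exact Equiv.Perm.sum_comp (Equiv.swap (i - 1) (j - 1)) (range 5) (fun s => B (s + 1)) hs
  unfold piNorm
  rw [hprod, hsum]
  simp [Function.comp, e0]

/-- Admissibility is symmetric in `B₁,…,B₅` (here: under the transposition of the slots `3, 5`, which permutes the
`c_jk`). [cite: Zudilin2004, Sect. 4, (4.7) and (4.12)] -/
theorem admissible_comp_swap35 {B : ℕ → ℤ} (hB : Admissible B) : Admissible (B ∘ Equiv.swap 3 5) := by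
  unfold Admissible cParams at hB ⊢
  simp only [List.mem_cons, List.not_mem_nil, or_false, forall_eq_or_imp, forall_eq] at hB ⊢
  have s0 : Equiv.swap (3 : ℕ) 5 0 = 0 := Equiv.swap_apply_of_ne_of_ne (by norm_num) (by norm_num)
  have s1 : Equiv.swap (3 : ℕ) 5 1 = 1 := Equiv.swap_apply_of_ne_of_ne (by norm_num) (by norm_num)
  have s2 : Equiv.swap (3 : ℕ) 5 2 = 2 := Equiv.swap_apply_of_ne_of_ne (by norm_num) (by norm_num)
  have s4 : Equiv.swap (3 : ℕ) 5 4 = 4 := Equiv.swap_apply_of_ne_of_ne (by norm_num) (by norm_num)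
  have s3 : Equiv.swap (3 : ℕ) 5 3 = 5 := Equiv.swap_apply_left _ _
  have s5 : Equiv.swap (3 : ℕ) 5 5 = 3 := Equiv.swap_apply_right _ _
  simp only [Function.comp, s0, s1, s2, s3, s4, s5]
  omega

/-- **Corollary (PROVED from the fact).** The `𝔊`-invariance for the conjugate generator on the slots `{1,3,4}`:
for admissible `B`, `F̃₅(B)/Π(B) = F̃₅(𝔱₁₃₄B)/Π(𝔱₁₃₄B)` — the form of the transport step used in the cell.
[cite: Zudilin2004, Sect. 4, paragraph before Lemma 9] -/
theorem baileyTransform.slots134 (hBT : baileyTransform) (B : ℕ → ℤ) (hB : Admissible B) :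
    vwpDual 5 B / (piNorm B : ℝ) = vwpDual 5 (tau134 B) / (piNorm (tau134 B) : ℝ) := by
  have h3 : (3 : ℕ) ∈ Icc 1 5 := by simp
  have h5 : (5 : ℕ) ∈ Icc 1 5 := by simp
  have hB' := admissible_comp_swap35 hB
  have step := hBT (B ∘ Equiv.swap 3 5) hB'
  rw [vwpDual_comp_swap 5 B h3 h5, piNorm_comp_swap B h3 h5] at step
  rw [step, tau134_eq, vwpDual_comp_swap 5 _ h3 h5, piNorm_comp_swap _ h3 h5]

/-! ### Sanity checks (not citable): admissibility and the action of `𝔱` on a sample point -/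

example : Admissible (fun j => (([10, 3, 3, 2, 2, 2] : List ℤ).getD j 0)) := by decide

example : (List.range 6).map (tau fun j => (([10, 3, 3, 2, 2, 2] : List ℤ).getD j 0)) = [13, 6, 3, 2, 5, 5] := by
  decide

example : Admissible (tau fun j => (([10, 3, 3, 2, 2, 2] : List ℤ).getD j 0)) := by decide

end Literature.NumberTheory.Irrationality.Zudilin2004
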